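import Literature.MathematicalPhysics.QuantumLattice.LatticeGaugeDLRFreeEnergyProofs
import Literature.MathematicalPhysics.QuantumLattice.LatticeGaugeDLRGibbsProofs
import Mathlib.Analysis.Convex.Integral
import Mathlib.Analysis.Convex.SpecificFunctions.Basic
import HarnessLib

/-!
# Jensen inequality in the perturbation for the log-normaliser of the lattice Yang–Mills kernel

Helper (T1 of the tangent programme) for line `Sketch` of crux `FibreToTorus`
(stmt-QuantumFields-16244), route `ContractibleFibre`.  For a bounded measurable perturbation
`Φ` of the lattice Yang–Mills kernel `ymSpecification ρ β Λ η` put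
`N(Φ) := ∫ exp (-β S_Λ(ζ ∨ η) + Φ(ζ ∨ η)) dζ` (product Haar measure on the edges of `Λ`,
boundary condition `η` glued outside), so that `N(0)` is the normaliser of the kernel.  We prove
the finite-volume tangent (Gibbs / Jensen) inequality
`log N(Φ) - log N(0) ≥ ⟨Φ⟩_{γ^{β,η}_Λ}`.
Proof: by the kernel integral formula `N(Φ) / N(0) = ∫ exp Φ dγ^{β,η}_Λ`, and Jensen's
inequality for `exp` on the probability measure `γ^{β,η}_Λ` gives
`exp (∫ Φ dγ^{β,η}_Λ) ≤ N(Φ) / N(0)`; take logarithms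
(Friedli–Velenik 2017, Lemma 6.89 / Prop. 6.91 pattern; Israel 1979, §I.3).
-/

noncomputable section
open MeasureTheory Filter Topology Finset
open Literature.Probability.LatticeModels (Site halfOpenBox glueWith)
open Literature.MathematicalPhysics.QuantumLattice (LGConfig ZdEdge ZdPlaquette plaquetteObs plaquetteEdges
  plaquettesTouching wilsonBoundaryAction ymSpecification ymGibbsMeasures IsZdTranslationInvariant
  freeEnergyDensity configShift LocalGaugeObservable IsCylinder)
open Literature.MathematicalPhysics.QuantumFieldTheory (haarProbability zdHaar)

namespace Summit.QuantumFields.YangMills.Theorems.FibreToTorus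

/-- **Jensen inequality in the perturbation for the kernel log-normaliser.** With
`N(Φ) = ∫ exp (-β S_Λ(ζ ∨ η) + Φ(ζ ∨ η)) dζ` for a bounded measurable `Φ`, so that `N(0)` is the
normaliser of `ymSpecification ρ β Λ η`,
`log N(0) + ∫ Φ dγ^{β,η}_Λ ≤ log N(Φ)` (convexity of the perturbed finite-volume pressure,
tangent below the graph; Friedli–Velenik 2017, Lemma 6.89; Israel 1979, §I.3). [folklore] -/
theorem tangent_logNormaliser_jensen : ∀ (d N : ℕ) (G : Type) [Group G] [TopologicalSpace G] [IsTopologicalGroup G] [CompactSpace G] [MeasurableSpace G] [BorelSpace G] [SecondCountableTopology G] (ρ : G →* Matrix (Fin N) (Fin N) ℂ), Continuous ρ → ∀ (Λ : Finset (ZdEdge d)) (η : LGConfig d G) (β : ℝ) (Φ : LGConfig d G → ℝ), Measurable Φ → (∃ C : ℝ, ∀ U, |Φ U| ≤ C) → Real.log (∫ ζ, Real.exp (-β * wilsonBoundaryAction ρ Λ (glueWith Λ ζ η)) ∂(MeasureTheory.Measure.pi fun _ : ↥Λ => haarProbability G)) + ∫ U, Φ U ∂(ymSpecification ρ β Λ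 η) ≤ Real.log (∫ ζ, Real.exp (-β * wilsonBoundaryAction ρ Λ (glueWith Λ ζ η) + Φ (glueWith Λ ζ η)) ∂(MeasureTheory.Measure.pi fun _ : ↥Λ => haarProbability G)) := by
  intro d N G _ _ _ _ _ _ _ ρ hρ Λ η β Φ hΦm hΦb
  obtain ⟨C, hC⟩ := hΦb
  -- positivity of the normaliser `N(0)` and the probability kernel `γ := γ^{β,η}_Λ`
  have hN0 := Literature.MathematicalPhysics.QuantumLattice.normaliser_pos ρ hρ β Λ η
  haveI := Literature.MathematicalPhysics.QuantumLattice.isProbabilityMeasure_ymSpecification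
    ρ hρ β Λ η
  -- the action is continuous; `Φ` and `exp Φ` are bounded measurable, hence `γ`-integrable
  have hS : Continuous (wilsonBoundaryAction (G := G) ρ Λ) :=
    Literature.MathematicalPhysics.QuantumLattice.continuous_wilsonBoundaryAction ρ hρ Λ
  have heΦm : Measurable fun U : LGConfig d G => Real.exp (Φ U) := Real.measurable_exp.comp hΦm
  have heΦb : ∀ U : LGConfig d G, |Real.exp (Φ U)| ≤ Real.exp C := fun U => by
    rw [abs_of_pos (Real.exp_pos _)]
    exact Real.exp_le_exp.2 ((le_abs_self _).trans (hC U))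
  have hΦi : Integrable Φ (ymSpecification ρ β Λ η) :=
    Literature.MathematicalPhysics.QuantumLattice.integrable_of_bound hΦm.aestronglyMeasurable hC
  have heΦi : Integrable (Real.exp ∘ Φ) (ymSpecification ρ β Λ η) :=
    Literature.MathematicalPhysics.QuantumLattice.integrable_of_bound heΦm.aestronglyMeasurable
      heΦb
  -- positivity of the perturbed normaliser `N(Φ)`
  have hg : Measurable fun ζ : ↥Λ → G => glueWith Λ ζ η :=
    Literature.Probability.LatticeModels.measurable_glueWith Λ η
  have hw : Continuous fun ζ : ↥Λ → G => -β * wilsonBoundaryAction ρ Λ (glueWith Λ ζ η) :=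
    continuous_const.mul (hS.comp
      ((Literature.MathematicalPhysics.QuantumLattice.continuous_glueWith_prod Λ).comp
        (Continuous.prodMk_right η)))
  obtain ⟨B, hB⟩ := Literature.MathematicalPhysics.QuantumLattice.exists_bound_of_continuous hw
  have hNΦ : 0 < ∫ ζ, Real.exp (-β * wilsonBoundaryAction ρ Λ (glueWith Λ ζ η) + Φ (glueWith Λ ζ η))
      ∂(Measure.pi fun _ : ↥Λ => haarProbability G) := by
    refine integral_exp_pos
      (Literature.MathematicalPhysics.QuantumLattice.integrable_of_bound
        (Real.measurable_exp.comp (hw.measurable.add (hΦm.comp hg))).aestronglyMeasurable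
        (C := Real.exp (B + C)) fun ζ => ?_)
    rw [abs_of_pos (Real.exp_pos _)]
    exact Real.exp_le_exp.2
      (add_le_add ((le_abs_self _).trans (hB ζ)) ((le_abs_self _).trans (hC _)))
  -- kernel integral formula: `γ(exp Φ) = N(Φ) / N(0)`
  have hkey : ∫ U, Real.exp (Φ U) ∂(ymSpecification ρ β Λ η) =
      (∫ ζ, Real.exp (-β * wilsonBoundaryAction ρ Λ (glueWith Λ ζ η) + Φ (glueWith Λ ζ η))
          ∂(Measure.pi fun _ : ↥Λ => haarProbability G)) /
        ∫ ζ, Real.exp (-β * wilsonBoundaryAction ρ Λ (glueWith Λ ζ η))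
          ∂(Measure.pi fun _ : ↥Λ => haarProbability G) := by
    rw [Literature.MathematicalPhysics.QuantumLattice.integral_ymSpecification ρ hρ β Λ heΦm η]
    congr 1
    refine congrArg (fun g : (↥Λ → G) → ℝ => ∫ ζ, g ζ ∂(Measure.pi fun _ : ↥Λ => haarProbability G))
      (funext fun ζ => ?_)
    rw [← Real.exp_add]
    congr 1
    ring
  -- Jensen for the convex `exp` on the probability measure `γ`
  have hJ : Real.exp (∫ U, Φ U ∂(ymSpecification ρ β Λ η)) ≤
      ∫ U, Real.exp (Φ U) ∂(ymSpecification ρ β Λ η) :=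
    convexOn_exp.map_integral_le Real.continuous_exp.continuousOn isClosed_univ
      (ae_of_all _ fun _ => Set.mem_univ _) hΦi heΦi
  rw [hkey] at hJ
  -- take logarithms
  have hlog := (Real.le_log_iff_exp_le (div_pos hNΦ hN0)).2 hJ
  rw [Real.log_div hNΦ.ne' hN0.ne'] at hlog
  linarith

end Summit.QuantumFields.YangMills.Theorems.FibreToTorus

end
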